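import Mathlib
import Literature.MathematicalPhysics.QuantumFieldTheory.GaugeOSData
import Literature.MathematicalPhysics.QuantumLattice.WilsonBlockHeatBathLightCone2
import Summits.QuantumFields.YangMills.Theorems.ConvexGribovBodyContinuumLegGivenGapStubBilinearUBP
import Summits.QuantumFields.YangMills.Theorems.ConvexGribovBodyContinuumLegGivenGapStubPairToNorm
import HarnessLib

/-!
# `ContinuumLegGivenGap` (stmt-QuantumFields-8782), line `Sketch` — stub `stub_alongSequence`

Support file for the crux item stmt-QuantumFields-8782
(`Summit.QuantumFields.YangMills.Theses.ConvexGribovBody.ContinuumLegGivenGap`), registered stub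
`stub_alongSequence` of the line `Sketch` (reshape 6, skeleton `Cruxes/ContinuumLegGivenGap/Lines/Sketch.lean`;
the statement is the helper `adapter_along_sequence` registered by lead c1).

**Statement.** For a compact gauge group `G` (Borel σ-algebra), a lattice representation `r` and ANY
sequence of couplings `βs : ℕ → ℝ`: if at each index `k` the torus Wilson states at `βs k` cluster in
Euclidean time at some rate `μ_k > 0` with PER-PAIR, PER-INDEX constants
(`TorusClusteringAt r (βs k) μ_k`: `|corr_{βs k, 2S+1}(A, B; n)| ≤ C_k(A, B) e^{−μ_k n}` for all `S`,
`n ≤ S`), then there are rates `m_k > 0` and INDEX-FREE per-pair constants `C(A, B)` with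
`|corr_{βs k, 2S+1}(A, B; n)| ≤ C(A, B) e^{−m_k n}` for all `k`, `S`, `n ≤ S`.

**Proof** (the landed `stub_compose`, with its cover by coupling intervals replaced by the sequence
index). Enumerate the countably many support-box pairs `e : ℕ → _`; let `f j k S n` be the supremum of
`|corr_{βs k, 2S+1}(A, B; n)|` over the pairs with supports `e j` and sup norms `≤ 1` (a priori `≤ 2`,
tree `abs_latticeConnectedCorr_le_two_mul`). At each index `k` the landed pair-to-norm upgrade
`stub_pairToNorm stub_bilinearUBP` (Banach–Steinhaus twice on the Banach spaces of bounded measurable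
gauge-invariant cylinder observables) turns the per-pair constants into ONE constant per box pair, so
`f j k` has the H-shape at rate `μ_k`; a ONE-SIDED diagonal argument (inside the proof: sacrifice the
rate at index `k` by the log-constants of the finitely many box pairs `j ≤ k`,
`m_k := μ_k / (1 + ∑_{j ≤ k} log⁺ K_{k j})`, and absorb the finitely many indices `k < j` into the
constant of `j` — simpler than the sibling's two-sided `uniformShape_of_cover`, and free of its route
imports) gives rates `m_k > 0` and `k`-free constants `C_j` for the suprema; reading back to a pair `(A, B)` is the bilinear rescaling
`corr(a A', b B') = a b · corr(A', B')`, `a = ‖A‖∞`, `b = ‖B‖∞`.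

No definitions, no facts; Mathlib + landed tree lemmas only (imports: two Literature modules and the two
landed functional-analysis stubs; no route file). [folklore]
-/

noncomputable section

namespace Summit.QuantumFields.YangMills.Theorems.ContinuumLegGivenGap

open Literature.MathematicalPhysics.QuantumFieldTheory
open Literature.MathematicalPhysics.QuantumLattice (LGConfig)
open Literature.MathematicalPhysics.QuantumLattice.WilsonBlockHeatBath
  (abs_latticeConnectedCorr_le_two_mul)

/-- Unit-ball normalisation of a local gauge-invariant observable: `A = ‖A‖∞ • A'` with `A'` of the
same support and `‖A'‖∞ ≤ 1` (reproduced from the landed `exists_unit_rescale`,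
`…StubCompose.lean` p107280, whose module is not yet served by the check farm). [folklore] -/
theorem exists_unit_smul_rescale {G : Type} [Group G] [MeasurableSpace G] (A : YMSpecies G) :
    ∃ A' : YMSpecies G, A'.supp = A.supp ∧ (∀ U, |A'.F U| ≤ 1) ∧ A.F = (⨆ V, |A.F V|) • A'.F := by
  have hbdd : BddAbove (Set.range fun V => |A.F V|) := by
    obtain ⟨C, hC⟩ := A.bounded
    exact ⟨C, by rintro _ ⟨V, rfl⟩; exact hC V⟩
  have hle : ∀ U, |A.F U| ≤ ⨆ V, |A.F V| := fun U => le_ciSup hbdd U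
  have h0 : 0 ≤ ⨆ V, |A.F V| := Real.iSup_nonneg fun V => abs_nonneg _
  set a : ℝ := ⨆ V, |A.F V| with ha
  have h1 : ∀ U, |a⁻¹ * A.F U| ≤ 1 := fun U => by
    rw [abs_mul, abs_inv, abs_of_nonneg h0]
    rcases eq_or_lt_of_le h0 with h | h
    · rw [← h, inv_zero, zero_mul]; exact zero_le_one
    · exact (inv_mul_le_one₀ h).2 (hle U)
  have h2 : ∀ U, A.F U = a * (a⁻¹ * A.F U) := fun U => by
    rcases eq_or_lt_of_le h0 with h | h
    · rw [← h, zero_mul]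
      exact abs_nonpos_iff.1 ((hle U).trans_eq h.symm)
    · rw [mul_inv_cancel_left₀ h.ne']
  refine ⟨{ F := fun U => a⁻¹ * A.F U
            supp := A.supp
            isCylinder := by
              intro U V hUV
              exact congrArg (fun x => a⁻¹ * x) (A.isCylinder hUV)
            gaugeInvariant := by
              intro g U
              exact congrArg (fun x => a⁻¹ * x) (A.gaugeInvariant g U)
            bounded := ⟨1, h1⟩
            measurable := A.measurable.const_mul _ }, rfl, h1, ?_⟩
  funext U
  simp only [Pi.smul_apply, smul_eq_mul]
  exact h2 U

/-- **Along any sequence of couplings the uniform shape is free** (registered stub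
`stub_alongSequence` of stmt-8782, line `Sketch` reshape 6; = lead c1's registered helper
`adapter_along_sequence`): per-index volume-uniform torus clustering with per-pair, per-index
constants upgrades to INDEX-FREE per-pair constants at positive (sacrificed) rates `m_k`. Pair-to-norm
per support-box pair (`stub_pairToNorm stub_bilinearUBP`), unit-ball suprema (a priori `≤ 2`), the
one-sided diagonal argument (rate sacrifice by the log-constants of the box pairs `j ≤ k`), bilinear
rescaling. [folklore] -/
theorem stub_alongSequence :
    ∀ (G : Type) [Group G] [TopologicalSpace G] [IsTopologicalGroup G] [CompactSpace G]
      [MeasurableSpace G] [BorelSpace G] (r : LatticeRep G) (βs : ℕ → ℝ),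
      (∀ k : ℕ, ∃ m : ℝ, 0 < m ∧ TorusClusteringAt r (βs k) m) →
        ∃ m : ℕ → ℝ, (∀ k, 0 < m k) ∧ ∀ A B : YMSpecies G, ∃ C : ℝ, ∀ k S n : ℕ, n ≤ S →
          |latticeConnectedCorr r.ρ (βs k) (2 * S + 1) A.F B.F n| ≤ C * Real.exp (-(m k * n)) := by
  intro G _ _ _ _ _ _ r βs hH
  -- the landed pair-to-norm upgrade (Banach–Steinhaus twice)
  have hPN := stub_pairToNorm stub_bilinearUBP
  -- enumerate the countably many support-box pairs
  obtain ⟨e, he⟩ := exists_surjective_nat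
    (Finset (Literature.MathematicalPhysics.QuantumLattice.ZdEdge 4) ×
      Finset (Literature.MathematicalPhysics.QuantumLattice.ZdEdge 4))
  -- the unit-ball suprema of the correlations over the box pair `e j` at the coupling `βs k`
  obtain ⟨f, hf⟩ : ∃ f : ℕ → ℕ → ℕ → ℕ → ℝ, ∀ j k S n, f j k S n =
      ⨆ p : {p : YMSpecies G × YMSpecies G // p.1.supp = (e j).1 ∧ p.2.supp = (e j).2 ∧
          (∀ U, |p.1.F U| ≤ 1) ∧ ∀ U, |p.2.F U| ≤ 1},
        |latticeConnectedCorr r.ρ (βs k) (2 * S + 1) p.1.1.F p.1.2.F n| :=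
    ⟨_, fun _ _ _ _ => rfl⟩
  have hf0 : ∀ j k S n, 0 ≤ f j k S n := fun j k S n => by
    rw [hf]; exact Real.iSup_nonneg fun p => abs_nonneg _
  -- a priori bound `f ≤ 2`
  have hf2 : ∀ j k S n, |f j k S n| ≤ (2 : ℝ) := fun j k S n => by
    rw [abs_of_nonneg (hf0 j k S n), hf]
    refine Real.iSup_le (fun p => ?_) zero_le_two
    have := abs_latticeConnectedCorr_le_two_mul r (βs k) (2 * S + 1) p.2.2.2.1 p.2.2.2.2 n
    linarith
  -- at each index: the common rate `μ_k`, per-box-pair product constants by pair-to-norm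
  have hunif : ∀ k : ℕ, ∃ μ : ℝ, 0 < μ ∧ ∀ j : ℕ, ∃ C : ℝ, ∀ S n : ℕ, n ≤ S →
      |f j k S n| ≤ C * Real.exp (-(μ * n)) := by
    intro k
    obtain ⟨μ, hμ, hT⟩ := hH k
    refine ⟨μ, hμ, fun j => ?_⟩
    obtain ⟨K, hK⟩ := hPN G r (e j).1 (e j).2 (fun β S n => β = βs k ∧ n ≤ S)
      (fun _ _ n => Real.exp (-(μ * n))) (fun _ _ _ _ => Real.exp_pos _)
      (fun A B _ _ => by
        obtain ⟨C, hC⟩ := hT A B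
        refine ⟨C, fun β S n hP => ?_⟩
        obtain ⟨rfl, hn⟩ := hP
        exact hC S n hn)
    refine ⟨max K 0, fun S n hn => ?_⟩
    rw [abs_of_nonneg (hf0 j k S n), hf]
    have hw : 0 ≤ Real.exp (-(μ * n)) := (Real.exp_pos _).le
    refine Real.iSup_le (fun p => ?_) (mul_nonneg (le_max_right _ _) hw)
    have ha0 : 0 ≤ ⨆ U, |p.1.1.F U| := Real.iSup_nonneg fun U => abs_nonneg _
    have hb0 : 0 ≤ ⨆ U, |p.1.2.F U| := Real.iSup_nonneg fun U => abs_nonneg _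
    have ha1 : ⨆ U, |p.1.1.F U| ≤ 1 := Real.iSup_le p.2.2.2.1 zero_le_one
    have hb1 : ⨆ U, |p.1.2.F U| ≤ 1 := Real.iSup_le p.2.2.2.2 zero_le_one
    calc |latticeConnectedCorr r.ρ (βs k) (2 * S + 1) p.1.1.F p.1.2.F n|
        ≤ K * (⨆ U, |p.1.1.F U|) * (⨆ U, |p.1.2.F U|) * Real.exp (-(μ * n)) :=
          hK p.1.1 p.1.2 p.2.1 p.2.2.1 (βs k) S n ⟨rfl, hn⟩
      _ ≤ max K 0 * (⨆ U, |p.1.1.F U|) * (⨆ U, |p.1.2.F U|) * Real.exp (-(μ * n)) :=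
          mul_le_mul_of_nonneg_right (mul_le_mul_of_nonneg_right
            (mul_le_mul_of_nonneg_right (le_max_left K 0) ha0) hb0) hw
      _ = max K 0 * Real.exp (-(μ * n)) * ((⨆ U, |p.1.1.F U|) * ⨆ U, |p.1.2.F U|) := by ring
      _ ≤ max K 0 * Real.exp (-(μ * n)) :=
          mul_le_of_le_one_right (mul_nonneg (le_max_right _ _) hw) (mul_le_one₀ ha1 hb0 hb1)
  -- ONE-SIDED DIAGONAL LEMMA along the sequence (simpler than the sibling's two-sided
  -- `uniformShape_of_cover`, and free of its route-file imports): rates `m_k := μ_k / M_k`,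
  -- `M_k := 1 + ∑_{j ≤ k} log⁺ C_{k j}`; `k`-free constants `e · max 1 a_j + ∑_{k < j} max 1 C_{k j}`.
  have hdiag : ∃ m : ℕ → ℝ, (∀ k, 0 < m k) ∧ ∀ j : ℕ, ∃ C : ℝ, ∀ k S n : ℕ, n ≤ S →
      |f j k S n| ≤ C * Real.exp (-(m k * n)) := by
    choose μ hμ C hC using hunif
    -- log-constants `L k j := log (max 1 (C k j)) ≥ 0`, `max 1 (C k j) = exp (L k j)`
    set L : ℕ → ℕ → ℝ := fun k j => Real.log (max 1 (C k j)) with hL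
    have hL0 : ∀ k j, 0 ≤ L k j := fun k j => Real.log_nonneg (le_max_left _ _)
    have hCL : ∀ k j, max 1 (C k j) = Real.exp (L k j) := fun k j => by
      simp only [hL]; rw [Real.exp_log (lt_of_lt_of_le one_pos (le_max_left _ _))]
    -- `M k := 1 + ∑_{j ≤ k} L k j ≥ 1` dominates `1 + L k j` for `j ≤ k`
    set M : ℕ → ℝ := fun k => 1 + ∑ j ∈ Finset.range (k + 1), L k j with hM
    have hM1 : ∀ k, 1 ≤ M k := fun k => by
      have := Finset.sum_nonneg (s := Finset.range (k + 1)) (fun j _ => hL0 k j)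
      simp only [hM]; linarith
    have hLM : ∀ k j, j ≤ k → L k j ≤ M k - 1 := fun k j hjk => by
      have h1 : L k j ≤ ∑ j' ∈ Finset.range (k + 1), L k j' :=
        Finset.single_le_sum (f := fun j' => L k j') (fun j' _ => hL0 k j')
          (Finset.mem_range.2 (Nat.lt_succ_of_le hjk))
      simp only [hM]; linarith
    refine ⟨fun k => μ k / M k, fun k => div_pos (hμ k) (lt_of_lt_of_le one_pos (hM1 k)), fun j => ?_⟩
    -- the `k`-free constant of the pair `j`
    refine ⟨Real.exp 1 * max 1 (2 : ℝ) + ∑ k ∈ Finset.range j, max 1 (C k j), fun k S n hn => ?_⟩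
    have hx0 : 0 ≤ μ k * n := mul_nonneg (hμ k).le (Nat.cast_nonneg n)
    have hMk : 0 < M k := lt_of_lt_of_le one_pos (hM1 k)
    have hrate : Real.exp (-(μ k / M k * n)) = Real.exp (-(μ k * n / M k)) := by
      rw [div_mul_eq_mul_div]
    have hsum0 : 0 ≤ ∑ k' ∈ Finset.range j, max 1 (C k' j) :=
      Finset.sum_nonneg fun k' _ => le_trans zero_le_one (le_max_left _ _)
    have ha1 : 0 ≤ Real.exp 1 * max 1 (2 : ℝ) :=
      mul_nonneg (Real.exp_pos _).le (le_trans zero_le_one (le_max_left _ _))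
    rw [hrate]
    rcases lt_or_ge k j with hkj | hjk
    · -- `k < j`: no rate sacrifice needed beyond `m_k ≤ μ_k`; the constant `max 1 (C k j)` is absorbed
      have h1 : |f j k S n| ≤ max 1 (C k j) * Real.exp (-(μ k * n)) :=
        (hC k j S n hn).trans (mul_le_mul_of_nonneg_right (le_max_right _ _) (Real.exp_pos _).le)
      have h2 : Real.exp (-(μ k * n)) ≤ Real.exp (-(μ k * n / M k)) := by
        apply Real.exp_le_exp.2
        have : μ k * n / M k ≤ μ k * n := div_le_self hx0 (hM1 k)
        linarith
      have h3 : max 1 (C k j) ≤ Real.exp 1 * max 1 (2 : ℝ) + ∑ k' ∈ Finset.range j, max 1 (C k' j) := by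
        have := Finset.single_le_sum (f := fun k' => max 1 (C k' j))
          (fun k' _ => le_trans zero_le_one (le_max_left _ _)) (Finset.mem_range.2 hkj)
        linarith
      calc |f j k S n| ≤ max 1 (C k j) * Real.exp (-(μ k * n)) := h1
        _ ≤ max 1 (C k j) * Real.exp (-(μ k * n / M k)) :=
            mul_le_mul_of_nonneg_left h2 (le_trans zero_le_one (le_max_left _ _))
        _ ≤ (Real.exp 1 * max 1 (2 : ℝ) + ∑ k' ∈ Finset.range j, max 1 (C k' j)) *
              Real.exp (-(μ k * n / M k)) :=
            mul_le_mul_of_nonneg_right h3 (Real.exp_pos _).le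
    · -- `j ≤ k`: rate sacrifice by `M k`
      have hkey : |f j k S n| ≤ Real.exp 1 * max 1 (2 : ℝ) * Real.exp (-(μ k * n / M k)) := by
        rcases le_or_gt (μ k * n) (M k) with hsmall | hlarge
        · -- short times: the a priori bound, `1 ≤ e · e^{-μ n / M}`
          have h1 : |f j k S n| ≤ max 1 (2 : ℝ) := (hf2 j k S n).trans (le_max_right _ _)
          have h2 : 1 ≤ Real.exp 1 * Real.exp (-(μ k * n / M k)) := by
            rw [← Real.exp_add]
            refine Real.one_le_exp (by linarith [(div_le_one hMk).2 hsmall])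
          calc |f j k S n| ≤ max 1 (2 : ℝ) * 1 := by rw [mul_one]; exact h1
            _ ≤ max 1 (2 : ℝ) * (Real.exp 1 * Real.exp (-(μ k * n / M k))) :=
                mul_le_mul_of_nonneg_left h2 (le_trans zero_le_one (le_max_left _ _))
            _ = Real.exp 1 * max 1 (2 : ℝ) * Real.exp (-(μ k * n / M k)) := by ring
        · -- long times: `C e^{-μ n} ≤ e^{M - 1 - μ n} ≤ e^{1 - μ n / M}`
          have h1 : |f j k S n| ≤ Real.exp (L k j) * Real.exp (-(μ k * n)) :=
            (hC k j S n hn).trans (mul_le_mul_of_nonneg_right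
              ((le_max_right _ _).trans (hCL k j).le) (Real.exp_pos _).le)
          set y : ℝ := μ k * n / M k with hy
          have hyM : y * M k = μ k * n := by simp only [hy]; field_simp
          have hy1 : 1 ≤ y := by
            rw [hy, le_div_iff₀ hMk, one_mul]; exact hlarge.le
          have hexp : L k j + -(μ k * n) ≤ 1 + -y := by
            have hLMk := hLM k j hjk
            nlinarith [hM1 k, hy1, hLMk, hyM]
          calc |f j k S n| ≤ Real.exp (L k j) * Real.exp (-(μ k * n)) := h1
            _ = Real.exp (L k j + -(μ k * n)) := (Real.exp_add _ _).symm
            _ ≤ Real.exp (1 + -y) := Real.exp_le_exp.2 hexp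
            _ = Real.exp 1 * 1 * Real.exp (-y) := by rw [Real.exp_add, mul_one]
            _ ≤ Real.exp 1 * max 1 (2 : ℝ) * Real.exp (-y) :=
                mul_le_mul_of_nonneg_right
                  (mul_le_mul_of_nonneg_left (le_max_left _ _) (Real.exp_pos _).le) (Real.exp_pos _).le
      calc |f j k S n| ≤ Real.exp 1 * max 1 (2 : ℝ) * Real.exp (-(μ k * n / M k)) := hkey
        _ ≤ (Real.exp 1 * max 1 (2 : ℝ) + ∑ k' ∈ Finset.range j, max 1 (C k' j)) *
              Real.exp (-(μ k * n / M k)) :=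
            mul_le_mul_of_nonneg_right (by linarith) (Real.exp_pos _).le
  obtain ⟨m, hm, hCj⟩ := hdiag
  refine ⟨m, hm, fun A B => ?_⟩
  -- read back to the pair `(A, B)` by bilinear rescaling
  obtain ⟨j, hj⟩ := he (A.supp, B.supp)
  obtain ⟨Cj, hCj⟩ := hCj j
  obtain ⟨A', hA's, hA'1, hA'e⟩ := exists_unit_smul_rescale A
  obtain ⟨B', hB's, hB'1, hB'e⟩ := exists_unit_smul_rescale B
  have ha0 : 0 ≤ ⨆ V, |A.F V| := Real.iSup_nonneg fun V => abs_nonneg _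
  have hb0 : 0 ≤ ⨆ V, |B.F V| := Real.iSup_nonneg fun V => abs_nonneg _
  refine ⟨(⨆ V, |A.F V|) * (⨆ V, |B.F V|) * Cj, fun k S n hn => ?_⟩
  have hj1 : (e j).1 = A.supp := by rw [hj]
  have hj2 : (e j).2 = B.supp := by rw [hj]
  have h1 : |latticeConnectedCorr r.ρ (βs k) (2 * S + 1) A'.F B'.F n| ≤ f j k S n := by
    rw [hf]
    refine le_ciSup_of_le ?_ ⟨(A', B'), hA's.trans hj1.symm, hB's.trans hj2.symm, hA'1, hB'1⟩
      le_rfl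
    refine ⟨2, ?_⟩
    rintro _ ⟨p, rfl⟩
    have := abs_latticeConnectedCorr_le_two_mul r (βs k) (2 * S + 1) p.2.2.2.1 p.2.2.2.2 n
    linarith
  have h2 : f j k S n ≤ Cj * Real.exp (-(m k * n)) := (le_abs_self _).trans (hCj k S n hn)
  have hcorr : latticeConnectedCorr r.ρ (βs k) (2 * S + 1) A.F B.F n =
      (⨆ V, |A.F V|) * ((⨆ V, |B.F V|) *
        latticeConnectedCorr r.ρ (βs k) (2 * S + 1) A'.F B'.F n) := by
    conv_lhs => rw [hA'e, hB'e]
    rw [PairToNorm.latticeConnectedCorr_smul_left, PairToNorm.latticeConnectedCorr_smul_right]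
  rw [hcorr, abs_mul, abs_mul, abs_of_nonneg ha0, abs_of_nonneg hb0, ← mul_assoc]
  calc (⨆ V, |A.F V|) * (⨆ V, |B.F V|) *
        |latticeConnectedCorr r.ρ (βs k) (2 * S + 1) A'.F B'.F n|
      ≤ (⨆ V, |A.F V|) * (⨆ V, |B.F V|) * (Cj * Real.exp (-(m k * n))) :=
        mul_le_mul_of_nonneg_left (h1.trans h2) (mul_nonneg ha0 hb0)
    _ = (⨆ V, |A.F V|) * (⨆ V, |B.F V|) * Cj * Real.exp (-(m k * n)) := by ring

end Summit.QuantumFields.YangMills.Theorems.ContinuumLegGivenGap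

end
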